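import Summits.QuantumFields.YangMills.Theorems.F4SubCurvatureDoorPlanarFrameTimeHolomorphy
import HarnessLib

/-!
# LINE g20-A «angular type» (crux ⟨stmt-QuantumFields-23035⟩): R0 in ALL THREE FRAMES — the hexagonal rotation and the transport
# «frames ±60° follow by D₆-invariance»

Free-hands work of the LEAD seat ym-line-sfw-p2 (gen 74), continuing `F4SubCurvatureDoorPlanarFrameTimeHolomorphy` (R0,
`planarFrameTimeHolomorphy`: complex translation along the frame-`0` time axis).  The owner's rung file says «frames ±60° follow by
D₆-invariance»; this file makes that literal, as the input R1⁺ `PlanarConicChart` consumes («two frames with `|y · n_θ| ≥ ‖y‖/2` + R0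
in those frames»):

* `hexReflection_eq_reflection` — the class's `hexReflection` IS Mathlib's mirror reflection `(ℝ ∙ n')ᗮ.reflection`, `n' = (½, √3/2)`;
* `hexRot` — the 60° rotation `R₆₀ = −θ₂ ∘ σ_{n'}` of the hexagonal group as a `LinearIsometryEquiv`, with `hexRot_apply`
  (`R₆₀ y = (y₀/2 − (√3/2)y₁, (√3/2)y₀ + y₁/2)`), `hexRot_single_zero` (`R₆₀ e₀ = n_{60°} = (½, √3/2)`) and the invariance
  `inPlanarClass_hexRot` (`k ∘ R₆₀ = k` from the three generators of the class);
* `frameTimeHolomorphy` — for ANY linear isometry `R` with `k ∘ R = k` and every `y` with `⟪y, R e₀⟫ ≠ 0`: `u ↦ k(y + u·R e₀)` is on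
  `(−|⟪y, Re₀⟫|, |⟪y, Re₀⟫|)` the trace of a function holomorphic on the disc of that radius, bounded by `k((⟪y, Re₀⟫ + Re u)·R e₀)`
  (R0 at the point `R⁻¹ y`); corollaries `frameTimeHolomorphy_sixty` / `_negSixty` for the frames `±60°` (`R = R₆₀`, `R₆₀⁻¹`).

HONEST LABEL: budget-free plumbing toward the XL stub (C) `PlanarSpectralCone`; (C), (A), the crux and every rung of LADDER-YM are
untouched; no summit is proved; the Yang–Mills mass gap is NOT proved by this.
-/

noncomputable section

namespace Summit.QuantumFields.YangMills.Cruxes.ShortRootRigidity.AngularTypeRungs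

open scoped Topology InnerProductSpace BigOperators
open Set Metric
open Literature.MathematicalPhysics.QuantumLattice (timeReflection timeReflection_apply)
open Literature.MathematicalPhysics.QuantumFieldTheory (mirrorReflection_apply)
open Summit.QuantumFields.YangMills.Theorems.F4SubCurvatureDoorSliceDensityRegistered (E2)
open Summit.QuantumFields.YangMills.Theorems.F4SubCurvatureDoorSliceInClassRegistered (hexReflection InPlanarClass)

/-! ## The hexagonal mirror and the 60° rotation -/

/-- The hexagonal normal `n' = (½, √3/2)` has unit norm. -/
theorem norm_hexNormal : ‖mk2 (1 / 2) (Real.sqrt 3 / 2)‖ = 1 := by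
  have h3 : Real.sqrt 3 ^ 2 = 3 := Real.sq_sqrt (by norm_num)
  have hsq : ‖mk2 (1 / 2) (Real.sqrt 3 / 2)‖ ^ 2 = 1 := by
    rw [EuclideanSpace.real_norm_sq_eq, Fin.sum_univ_two, mk2_apply_zero, mk2_apply_one]
    nlinarith [h3]
  have h0 : 0 ≤ ‖mk2 (1 / 2) (Real.sqrt 3 / 2)‖ := norm_nonneg _
  nlinarith [hsq, h0]

/-- `⟪x, n'⟫ = x₀/2 + (√3/2) x₁`. -/
theorem inner_hexNormal (x : E2) : ⟪x, mk2 (1 / 2) (Real.sqrt 3 / 2)⟫_ℝ = x 0 / 2 + Real.sqrt 3 / 2 * x 1 := by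
  rw [EuclideanSpace.inner_eq_star_dotProduct]
  simp [Fin.sum_univ_two, dotProduct, mk2]
  ring

/-- The class's `hexReflection` is Mathlib's mirror reflection in `n'^⊥`. -/
theorem hexReflection_eq_reflection (y : E2) :
    hexReflection y = (ℝ ∙ mk2 (1 / 2) (Real.sqrt 3 / 2))ᗮ.reflection y := by
  rw [mirrorReflection_apply, norm_hexNormal, inner_hexNormal]
  have h3 : Real.sqrt 3 * Real.sqrt 3 = 3 := Real.mul_self_sqrt (by norm_num)
  ext i
  fin_cases i
  · simp [hexReflection, mk2]
    ring
  · simp [hexReflection, mk2]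
    linear_combination (y 1 / 2) * h3

/-- The 60° rotation of the hexagonal group `D₆ = ⟨θ₂, σ_{n'}, −1⟩`: `R₆₀ := −θ₂ ∘ σ_{n'}`, a linear isometry of `ℝ²`.
[problem-side definition] -/
def hexRot : E2 ≃ₗᵢ[ℝ] E2 :=
  (((ℝ ∙ mk2 (1 / 2) (Real.sqrt 3 / 2))ᗮ.reflection.trans (timeReflection 2)).trans (LinearIsometryEquiv.neg ℝ))

/-- `R₆₀ y = −θ₂ (σ_{n'} y)`. -/
theorem hexRot_apply_eq (y : E2) : hexRot y = -(timeReflection 2 (hexReflection y)) := by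
  rw [hexReflection_eq_reflection]; rfl

/-- Coordinates of the 60° rotation: `R₆₀ y = (y₀/2 − (√3/2) y₁, (√3/2) y₀ + y₁/2)`. -/
theorem hexRot_apply (y : E2) :
    hexRot y = mk2 (y 0 / 2 - Real.sqrt 3 / 2 * y 1) (Real.sqrt 3 / 2 * y 0 + y 1 / 2) := by
  rw [hexRot_apply_eq]
  ext i
  fin_cases i
  · simp [hexReflection, timeReflection_apply, mk2]
  · simp [hexReflection, timeReflection_apply, mk2]
    ring

/-- `R₆₀ e₀ = n_{60°} = (½, √3/2)`. -/
theorem hexRot_single_zero : hexRot (EuclideanSpace.single 0 (1 : ℝ) : E2) = mk2 (1 / 2) (Real.sqrt 3 / 2) := by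
  rw [hexRot_apply]
  ext i
  fin_cases i <;> simp [mk2]

/-- `R₆₀⁻¹ e₀ = n_{−60°} = (½, −√3/2)`. -/
theorem hexRot_symm_single_zero :
    hexRot.symm (EuclideanSpace.single 0 (1 : ℝ) : E2) = mk2 (1 / 2) (-(Real.sqrt 3 / 2)) := by
  apply hexRot.injective
  rw [LinearIsometryEquiv.apply_symm_apply, hexRot_apply]
  have h3 : Real.sqrt 3 * Real.sqrt 3 = 3 := Real.mul_self_sqrt (by norm_num)
  ext i
  fin_cases i
  · simp [mk2]
    nlinarith [h3]
  · simp [mk2]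
    ring

variable {k : E2 → ℝ}

/-- A kernel of the planar class is invariant under the 60° rotation (time reflection, hexagonal reflection, `y ↦ −y`). -/
theorem inPlanarClass_hexRot (hk : InPlanarClass k) (y : E2) : k (hexRot y) = k y := by
  rw [hexRot_apply_eq, hk.2.2.2.2.1, hk.2.2.1, hk.2.2.2.1]

/-- … hence under its inverse. -/
theorem inPlanarClass_hexRot_symm (hk : InPlanarClass k) (y : E2) : k (hexRot.symm y) = k y := by
  conv_rhs => rw [← hexRot.apply_symm_apply y]
  exact (inPlanarClass_hexRot hk _).symm

/-! ## R0 transported to any frame of the class -/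

/-- `y' + u e₀ = (y'₀ + u, y'₁)`. -/
theorem add_smul_single_eq_mk2 (y : E2) (u : ℝ) :
    y + u • (EuclideanSpace.single 0 (1 : ℝ) : E2) = mk2 (y 0 + u) (y 1) := by
  ext i
  fin_cases i <;> simp [mk2]

/-- **R0 in the frame `R e₀`**: for a linear isometry `R` with `k ∘ R = k` and `⟪y, R e₀⟫ ≠ 0`, `u ↦ k(y + u·R e₀)` extends
holomorphically to the disc `|u| < |⟪y, R e₀⟫|` with the axis bound `k((⟪y, R e₀⟫ + Re u)·R e₀)`. -/
theorem frameTimeHolomorphy (hk : InPlanarClass k) (R : E2 ≃ₗᵢ[ℝ] E2) (hR : ∀ x, k (R x) = k x) (y : E2)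
    (hy : ⟪y, R (EuclideanSpace.single 0 (1 : ℝ))⟫_ℝ ≠ 0) :
    ∃ g : ℂ → ℂ, DifferentiableOn ℂ g (Metric.ball (0 : ℂ) |⟪y, R (EuclideanSpace.single 0 (1 : ℝ))⟫_ℝ|) ∧
      (∀ u : ℝ, |u| < |⟪y, R (EuclideanSpace.single 0 (1 : ℝ))⟫_ℝ| →
        g u = k (y + u • R (EuclideanSpace.single 0 (1 : ℝ)))) ∧
      ∀ w ∈ Metric.ball (0 : ℂ) |⟪y, R (EuclideanSpace.single 0 (1 : ℝ))⟫_ℝ|,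
        ‖g w‖ ≤ k ((⟪y, R (EuclideanSpace.single 0 (1 : ℝ))⟫_ℝ + w.re) • R (EuclideanSpace.single 0 (1 : ℝ))) := by
  set e : E2 := EuclideanSpace.single 0 (1 : ℝ) with he
  set y' : E2 := R.symm y with hy'
  have hinner : ⟪y, R e⟫_ℝ = y' 0 := by
    rw [hy', ← inner_single_zero (R.symm y), ← LinearIsometryEquiv.inner_map_map R (R.symm y) e,
      LinearIsometryEquiv.apply_symm_apply]
  have hy'0 : y' 0 ≠ 0 := by rwa [← hinner]
  obtain ⟨g, hgd, hgr, hgb⟩ := planarFrameTimeHolomorphy k hk y' hy'0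
  rw [hinner]
  refine ⟨g, hgd, fun u hu => ?_, fun w hw => ?_⟩
  · rw [hgr u hu, ← add_smul_single_eq_mk2, ← hR (y' + u • e), map_add, LinearIsometryEquiv.map_smul, hy',
      LinearIsometryEquiv.apply_symm_apply]
  · have := hgb w hw
    rwa [← smul_single_eq_mk2, ← hR ((y' 0 + w.re) • e), LinearIsometryEquiv.map_smul] at this

/-- **Frame `+60°`**: `u ↦ k(y + u·n_{60})`, `n_{60} = (½, √3/2)`, for `⟪y, n_{60}⟫ ≠ 0`. -/
theorem frameTimeHolomorphy_sixty (hk : InPlanarClass k) (y : E2) (hy : ⟪y, mk2 (1 / 2) (Real.sqrt 3 / 2)⟫_ℝ ≠ 0) :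
    ∃ g : ℂ → ℂ, DifferentiableOn ℂ g (Metric.ball (0 : ℂ) |⟪y, mk2 (1 / 2) (Real.sqrt 3 / 2)⟫_ℝ|) ∧
      (∀ u : ℝ, |u| < |⟪y, mk2 (1 / 2) (Real.sqrt 3 / 2)⟫_ℝ| → g u = k (y + u • mk2 (1 / 2) (Real.sqrt 3 / 2))) ∧
      ∀ w ∈ Metric.ball (0 : ℂ) |⟪y, mk2 (1 / 2) (Real.sqrt 3 / 2)⟫_ℝ|,
        ‖g w‖ ≤ k ((⟪y, mk2 (1 / 2) (Real.sqrt 3 / 2)⟫_ℝ + w.re) • mk2 (1 / 2) (Real.sqrt 3 / 2)) := by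
  have h := frameTimeHolomorphy hk hexRot (inPlanarClass_hexRot hk) y
  rw [hexRot_single_zero] at h
  exact h hy

/-- **Frame `−60°`**: `u ↦ k(y + u·n_{−60})`, `n_{−60} = (½, −√3/2)`, for `⟪y, n_{−60}⟫ ≠ 0`. -/
theorem frameTimeHolomorphy_negSixty (hk : InPlanarClass k) (y : E2)
    (hy : ⟪y, mk2 (1 / 2) (-(Real.sqrt 3 / 2))⟫_ℝ ≠ 0) :
    ∃ g : ℂ → ℂ, DifferentiableOn ℂ g (Metric.ball (0 : ℂ) |⟪y, mk2 (1 / 2) (-(Real.sqrt 3 / 2))⟫_ℝ|) ∧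
      (∀ u : ℝ, |u| < |⟪y, mk2 (1 / 2) (-(Real.sqrt 3 / 2))⟫_ℝ| →
        g u = k (y + u • mk2 (1 / 2) (-(Real.sqrt 3 / 2)))) ∧
      ∀ w ∈ Metric.ball (0 : ℂ) |⟪y, mk2 (1 / 2) (-(Real.sqrt 3 / 2))⟫_ℝ|,
        ‖g w‖ ≤ k ((⟪y, mk2 (1 / 2) (-(Real.sqrt 3 / 2))⟫_ℝ + w.re) • mk2 (1 / 2) (-(Real.sqrt 3 / 2))) := by
  have h := frameTimeHolomorphy hk hexRot.symm (inPlanarClass_hexRot_symm hk) y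
  rw [hexRot_symm_single_zero] at h
  exact h hy

end Summit.QuantumFields.YangMills.Cruxes.ShortRootRigidity.AngularTypeRungs

end
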